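import Literature.Analysis.FluidPDE.PlanarVorticityMoments
import Literature.Analysis.FunctionSpaces.EuclideanLogSobolevDecay
import Literature.Analysis.FunctionSpaces.CsiszarKullbackPinsker
import Mathlib.Analysis.SpecialFunctions.Gaussian.FourierTransform
import HarnessLib

/-!
# The relative entropy of a planar viscous vorticity with respect to the spreading Gaussian:
# Gallay–Wayne's entropy dissipation law and the explicit `L¹` relaxation rate to the Oseen vortex

Literature file (topic `Analysis/FluidPDE`), theorems only: no definitions, no named facts.
The printed statements (Th. Gallay, C. E. Wayne, *Global stability of vortex solutions of the
two-dimensional Navier–Stokes equation*, Comm. Math. Phys. 255 (2005) 97–129 =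
arXiv:math/0402449; held text pp. 5, 11–12, 14), in the self-similar variables
`ξ = x/√(νt)`, `τ = log t`, `ω(x,t) = t⁻¹ w(ξ, τ)`, `G(ξ) = (4π)⁻¹ e^{-|ξ|²/4}`:

* **Lemma 3.2** (p. 11): for a non-negative solution, the relative entropy
  `H(w) = ∫ w log (w/G)` is non-increasing, and (its proof, p. 12)
  `d/dτ H(w(τ)) = −I(w(τ))`, `I(w) = ∫ w |∇ log (w/G)|²` — computed for Schwartz data with the
  Osada / Giga–Miyakawa–Osada Gaussian lower bound (so that `log w` is tame), the transport terms
  vanishing by `∫ v·∇w = 0` and `∫ (ξ·v) w = 0` (antisymmetry of the Biot–Savart kernel);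
* **§3.4 "Convergence rate for positive solutions"** (p. 14): with the Csiszár–Kullback
  inequality `(1/2α)‖w − αG‖²_{L¹} ≤ H(w) − H(αG)` and the Stam–Gross logarithmic Sobolev
  inequality `H(w) − H(αG) ≤ I(w)`,
  "`H(w(τ)) − H(αG) ≤ (H(w₀) − H(αG)) e^{−τ}`, `τ ≥ 0`" and
  "`‖w(τ) − αG‖_{L¹} ≤ √(2α) (H(w₀) − H(αG))^{1/2} e^{−τ/2}`, `τ ≥ 0`. This shows that `w(τ)`
  converges to `αG` at the rate `e^{−τ/2}`, which is optimal in general … this provides an explicit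
  upper bound of the time needed for the solution to enter a given neighborhood of the vortex."

## What is typed (PHYSICAL variables; `e^{τ} ↔ T(t) = t − t₀ + t⋆`)

We do not change variables: for a classical planar solution on a convex time set `S`
(`IsClassicalNSSolutionOn` on `ℝ² = EuclideanSpace ℝ (Fin 2)`, scalar vorticity
`ω = PlanarEigenmode.vorticity`, its equation `IsClassicalNSSolutionOn.planarVorticity_eq` = MB (2.6),
uniform decay class `HasUniformRapidDecayOn` on the VORTICITY, Biot–Savart velocity
`u(s) = K₂ ∗ ω(s)`, curl-free force) the Gaussian is the spreading heat kernel of the same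
circulation `Γ = ∫ ω`, `g_s(x) = Γ (4πνT(s))⁻¹ exp(−‖x‖²/(4νT(s)))`, `T(s) = s − t₀ + t⋆` with a free
virtual time origin `t⋆ > 0`; under `t − t₀ + t⋆ = t⋆ e^{τ}` this is exactly Gallay–Wayne's `αG` and
their `e^{−τ}` is our `t⋆/T(t)`. Positivity and tameness of `log ω` (Gallay–Wayne's Schwartz +
Gaussian-lower-bound step) are HYPOTHESES here (`0 < ω`, `|log ω| ≤ L(1+‖x‖)^k`,
`‖∇ω‖ ≤ L(1+‖x‖)^k ω`, uniformly on `S`): the log-tame positive class.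

* §1 `IsClassicalNSSolutionOn.integral_log_mul_timeDerivWithin_planarVorticity_eq` — the
  Boltzmann entropy balance at a fixed time,
  `∫ (log ω + 1) ∂ₜω = −ν ∫ ‖∇ω‖²/ω + ∫ (log ω + 1) curl f`
  (transport term `∫ (u·∇)(ω log ω) = 0` by `div u = 0`; viscous term by Green's first identity
  against the growing weight `log ω + 1`, coordinatewise, no boundary terms);
* §2 `IsClassicalNSSolutionOn.hasDerivWithinAt_integral_mul_log_planarVorticity` — the entropy
  law within a convex time set, `d/dt ∫ ω log ω = −ν ∫ ‖∇ω‖²/ω + ∫ (log ω + 1) curl f`;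
* §3 `IsClassicalNSSolutionOn.hasDerivWithinAt_relEntropy_planarVorticity` — **Lemma 3.2's
  dissipation law in physical variables**: for curl-free force and `u = K₂ ∗ ω`, the relative
  entropy `H(s) = ∫ ω log (ω/g_s)` satisfies
  `dH/dt = −ν I_rel`, `I_rel = ∫ ‖∇ω‖²/ω − 2Γ/(νT) + (∫‖x‖²ω)/(4ν²T²)` (`= ∫ ω‖∇log(ω/g)‖²`), using the
  tree's moment laws (`dΓ/dt = 0`, `d/dt ∫‖x‖²ω = 4νΓ`, Majda–Bertozzi Prop. 1.14);
* §4 `IsClassicalNSSolutionOn.relEntropy_mul_le` — **§3.4, first display**: by the Stam–Gross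
  inequality (`Literature.Analysis.FunctionSpaces.integral_mul_log_le_fisher` at `τ = νT`),
  `dH/dt ≤ −H/T`, so `H(t)·T(t) ≤ H(t₀)·t⋆` for `t₀ ≤ t` in `S` (i.e. `H(τ) ≤ H(0)e^{−τ}`), and
  `relEntropy_le` — Lemma 3.2 as printed (`H` non-increasing);
* §5 `IsClassicalNSSolutionOn.integral_abs_planarVorticity_sub_gaussian_le` — **§3.4, second
  display**: by the Csiszár–Kullback–Pinsker inequality
  (`Literature.Analysis.FunctionSpaces.integral_abs_sub_le_sqrt`),
  `∫ |ω(t) − g_t| ≤ √(2 Γ H(t₀) t⋆ / T(t))` (i.e. `‖w(τ) − αG‖₁ ≤ √(2α H₀) e^{−τ/2}`).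

What is NOT here: the self-similar change of variables itself; sign-changing data (Gallay–Wayne:
"we do not know how to extend the entropy dissipation method to the general case"); the removal
of the positivity / log-tameness hypotheses via Gaussian lower bounds (Osada 1987); existence.
TODO(general form): a Gaussian centred at the (conserved) centre of vorticity `x_c ≠ 0`.

HONEST FRAMING (cell `ns-blowup`, bears_on LADDER-NS N1 crux `HeredityFromTwo`, MODEL lane
«child core = Lundgren cross-section of a positive profile»): identities and a-priori bounds of
PLANAR viscous vorticity dynamics; used in the cell only through Lundgren's transformation as a
relaxation clock of a stretched tube's cross-section towards the Burgers vortex. Nothing here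
asserts anything about Navier–Stokes regularity or blow-up in 3-D.

## References

* [GallayWayne2005] Th. Gallay, C. E. Wayne, Comm. Math. Phys. 255 (2005) 97–129 =
  arXiv:math/0402449 — Lemma 3.2 and its proof (pp. 11–12), §3.4 (p. 14). READ (held text).
* [MajdaBertozziCUP2002] A. J. Majda, A. L. Bertozzi, *Vorticity and Incompressible Flow*, CUP
  2002 — §1.7 Prop. 1.14 (moments), §2.1 (2.6) (vorticity equation).
* [BakryGentilLedoux2014] D. Bakry, I. Gentil, M. Ledoux, Springer 2014 — Prop. 6.2.5 (the
  logarithmic Sobolev inequality; tree `EuclideanLogSobolevDecay`).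
* [BoucheronLugosiMassart2013] S. Boucheron, G. Lugosi, P. Massart, OUP 2013 — Thm. 4.19 (Pinsker;
  tree `CsiszarKullbackPinsker`).
-/

noncomputable section

open MeasureTheory Set Function Filter InnerProductSpace
open _root_.Topology
open scoped ContDiff Laplacian RealInnerProductSpace Topology

namespace Literature.Analysis.FluidPDE

/-! ### §0 Weights and the decay package -/

section Weights

variable {X : Type*} [SeminormedAddCommGroup X]

/-- Weight algebra: `(1 + ‖x‖)^a · (1 + ‖x‖)^{-(a + m)} = (1 + ‖x‖)^{-m}`. [folklore] -/
private theorem pow_mul_rpow_neg_add (x : X) (a m : ℕ) :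
    (1 + ‖x‖) ^ a * (1 + ‖x‖) ^ (-((a + m : ℕ) : ℝ)) = (1 + ‖x‖) ^ (-(m : ℝ)) := by
  have hx : (0 : ℝ) < 1 + ‖x‖ := by positivity
  rw [← Real.rpow_natCast, ← Real.rpow_add hx]
  congr 1
  push_cast
  ring

/-- `1 ≤ (1 + ‖x‖)^a`. [folklore] -/
private theorem one_le_pow_one_add_norm (x : X) (a : ℕ) : (1 : ℝ) ≤ (1 + ‖x‖) ^ a :=
  one_le_pow₀ (by linarith [norm_nonneg x])

end Weights

section Planar

variable {S : Set ℝ} {ν : ℝ} {f u : ℝ → EuclideanSpace ℝ (Fin 2) → EuclideanSpace ℝ (Fin 2)}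
  {p : ℝ → EuclideanSpace ℝ (Fin 2) → ℝ}

/-- `dim ℝ² = 2 < 3`. [folklore] -/
private theorem finrank_lt_three : (Module.finrank ℝ (EuclideanSpace ℝ (Fin 2)) : ℝ) < 3 := by
  rw [finrank_euclideanSpace_fin]; norm_num

/-- The tree's weight exponent `0 + (dim ℝ² + 1)` is `3`. [folklore] -/
private theorem weightExp_eq_three :
    ((0 + (Module.finrank ℝ (EuclideanSpace ℝ (Fin 2)) + 1) : ℕ) : ℝ) = 3 := by
  rw [finrank_euclideanSpace_fin]; norm_num

/-- Integrability of a continuous function dominated by `C₁ (1+‖x‖)^a · C₂ (1+‖x‖)^{-(a+3)}`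
on `ℝ²`. [folklore] -/
private theorem integrable_of_growth_mul_decay₃ {G : Type*} [NormedAddCommGroup G]
    {g : EuclideanSpace ℝ (Fin 2) → G} (hg : Continuous g) {C₁ C₂ : ℝ} {a : ℕ}
    (h : ∀ x, ‖g x‖ ≤ C₁ * (1 + ‖x‖) ^ a * (C₂ * (1 + ‖x‖) ^ (-((a + 3 : ℕ) : ℝ)))) :
    Integrable g (volume : Measure (EuclideanSpace ℝ (Fin 2))) := by
  refine integrable_of_norm_le_rpow_neg hg (C := C₁ * C₂) (r := ((3 : ℕ) : ℝ))
    (by rw [finrank_euclideanSpace_fin]; norm_num) fun x => ?_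
  calc ‖g x‖ ≤ C₁ * (1 + ‖x‖) ^ a * (C₂ * (1 + ‖x‖) ^ (-((a + 3 : ℕ) : ℝ))) := h x
    _ = C₁ * C₂ * ((1 + ‖x‖) ^ a * (1 + ‖x‖) ^ (-((a + 3 : ℕ) : ℝ))) := by ring
    _ = C₁ * C₂ * (1 + ‖x‖) ^ (-((3 : ℕ) : ℝ)) := by rw [pow_mul_rpow_neg_add]

/-- The uniform decay package of the vorticity of a jointly smooth planar field at the weight
exponent `N`: ONE constant `C ≥ 0` with `|ω|, ‖∇ω‖, ‖∇²ω‖, |∂ₜω| ≤ C (1 + ‖x‖)^{-N}` on `S × ℝ²`.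
[folklore] -/
private theorem exists_planarVorticity_decay (hu : IsSmoothSpaceTimeOn S u) (hU : UniqueDiffOn ℝ S)
    (hω : HasUniformRapidDecayOn S (fun t x => PlanarEigenmode.vorticity (u t) x)) (N : ℕ) :
    ∃ C : ℝ, 0 ≤ C ∧ ∀ t ∈ S, ∀ x : EuclideanSpace ℝ (Fin 2),
      |PlanarEigenmode.vorticity (u t) x| ≤ C * (1 + ‖x‖) ^ (-(N : ℝ)) ∧
        ‖fderiv ℝ (PlanarEigenmode.vorticity (u t)) x‖ ≤ C * (1 + ‖x‖) ^ (-(N : ℝ)) ∧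
        ‖fderiv ℝ (fderiv ℝ (PlanarEigenmode.vorticity (u t))) x‖ ≤ C * (1 + ‖x‖) ^ (-(N : ℝ)) ∧
        |timeDerivWithin S (fun s y => PlanarEigenmode.vorticity (u s) y) t x| ≤
          C * (1 + ‖x‖) ^ (-(N : ℝ)) := by
  have hsm := PlanarEigenmode.isSmoothSpaceTimeOn_vorticity hu hU
  obtain ⟨A0, hA0, hA0b⟩ := hω.norm_le_rpow N
  obtain ⟨A1, hA1, hA1b⟩ := hω.norm_fderiv_le_rpow hsm hU N
  obtain ⟨A2, hA2, hA2b⟩ := hω.norm_fderiv_fderiv_le_rpow hsm hU N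
  obtain ⟨A3, hA3, hA3b⟩ := hω.norm_timeDerivWithin_le_rpow hsm hU N
  refine ⟨A0 + A1 + A2 + A3, by positivity, fun t ht x => ⟨?_, ?_, ?_, ?_⟩⟩
  · have h := hA0b t ht x
    rw [Real.norm_eq_abs] at h
    exact le_decay_of_le_decay x h (by linarith)
  · exact le_decay_of_le_decay x (hA1b t ht x) (by linarith)
  · exact le_decay_of_le_decay x (hA2b t ht x) (by linarith)
  · have h := hA3b t ht x
    rw [Real.norm_eq_abs] at h
    exact le_decay_of_le_decay x h (by linarith)

/-- A continuous `w` with `|w| ≤ C (1 + ‖x‖)^{-(a+3)}` on `ℝ²` is integrable and bounded by `C`.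
[folklore] -/
private theorem integrable_and_bounded_of_decay {w : EuclideanSpace ℝ (Fin 2) → ℝ} (hw : Continuous w)
    {C : ℝ} {a : ℕ} (hC : 0 ≤ C) (h0 : ∀ x, |w x| ≤ C * (1 + ‖x‖) ^ (-((a + 3 : ℕ) : ℝ))) :
    Integrable w (volume : Measure (EuclideanSpace ℝ (Fin 2))) ∧ ∀ x, |w x| ≤ C := by
  refine ⟨integrable_of_growth_mul_decay₃ hw (C₁ := 1) (C₂ := C) (a := a) fun x => ?_, fun x => ?_⟩
  · rw [Real.norm_eq_abs, one_mul]
    exact (h0 x).trans (le_mul_of_one_le_left (mul_nonneg hC (Real.rpow_nonneg (by positivity) _))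
      (one_le_pow_one_add_norm x a))
  · exact (h0 x).trans (mul_le_of_le_one_right hC (rpow_neg_le_one x (Nat.cast_nonneg _)))

/-! ### §1 The Boltzmann entropy balance at a fixed time -/

/-- The derivative of `ω log ω` for a positive `C¹` scalar: `D(ω log ω)_x = (log ω(x) + 1) Dω_x`.
[folklore] -/
private theorem fderiv_mul_log_eq {w : EuclideanSpace ℝ (Fin 2) → ℝ} (hw : Differentiable ℝ w)
    (hpos : ∀ x, 0 < w x) (x : EuclideanSpace ℝ (Fin 2)) :
    fderiv ℝ (fun y => w y * Real.log (w y)) x = (Real.log (w x) + 1) • fderiv ℝ w x := by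
  have h1 := (hw x).hasFDerivAt
  have h2 := h1.log (hpos x).ne'
  have h3 : HasFDerivAt (fun y => w y * Real.log (w y))
      (w x • ((w x)⁻¹ • fderiv ℝ w x) + Real.log (w x) • fderiv ℝ w x) x := h1.mul h2
  rw [h3.fderiv, smul_smul, mul_inv_cancel₀ (hpos x).ne', add_comm, add_smul, one_smul]

/-- The derivative of `log ω` for a positive `C¹` scalar: `D(log ω)_x = ω(x)⁻¹ Dω_x`. [folklore] -/
private theorem fderiv_log_eq {w : EuclideanSpace ℝ (Fin 2) → ℝ} (hw : Differentiable ℝ w)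
    (hpos : ∀ x, 0 < w x) (x : EuclideanSpace ℝ (Fin 2)) :
    fderiv ℝ (fun y => Real.log (w y) + 1) x = (w x)⁻¹ • fderiv ℝ w x := by
  have h2 := ((hw x).hasFDerivAt.log (hpos x).ne').add_const (1 : ℝ)
  rw [h2.fderiv]

/-- The constant of a growth bound `|log ω| ≤ L (1 + ‖x‖)^k` is nonnegative. [folklore] -/
private theorem nonneg_of_abs_le_mul_pow {θ : EuclideanSpace ℝ (Fin 2) → ℝ} {L : ℝ} {k : ℕ}
    (h : ∀ x, |θ x| ≤ L * (1 + ‖x‖) ^ k) : 0 ≤ L := by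
  have h0 := (abs_nonneg _).trans (h 0)
  simpa using h0

/-- **The Boltzmann entropy balance of a classical planar vorticity at a fixed time**
(Gallay–Wayne 2005, proof of Lemma 3.2, the computation of `d/dτ H`, in physical variables and
without the Gaussian weight). Let `(u, p)` be a classical solution of the planar Navier–Stokes
equations with force `f` on a time set `S` of unique differentiability whose scalar vorticity
`ω = curl u` has uniform rapid decay on `S`; at a time `t ∈ S` let `u(t)` be bounded, `ω(t) > 0`,
`|log ω(t)| ≤ L (1 + ‖x‖)^k` and `‖∇ω(t)‖ ≤ L (1 + ‖x‖)^k ω(t)`. Then `(log ω + 1) curl f(t) ∈ L¹` and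
`∫ (log ω + 1) ∂ₜω = −ν ∫ ‖∇ω‖²/ω + ∫ (log ω + 1) curl f`:
the vorticity equation `∂ₜω + (u·∇)ω = νΔω + curl f` (MB (2.6)) against the weight `log ω + 1`,
the transport term being `∫ (u·∇)(ω log ω) = 0` (`div u = 0`, decay) and the viscous term
`∫ (log ω + 1) Δω = −∫ ⟪∇ log ω, ∇ω⟫ = −∫ ‖∇ω‖²/ω` (Green's first identity, coordinatewise
integration by parts without boundary terms). [cite: GallayWayne2005, Lemma 3.2 (proof, p. 12)] -/
theorem IsClassicalNSSolutionOn.integral_log_mul_timeDerivWithin_planarVorticity_eq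
    (h : IsClassicalNSSolutionOn S ν f u p) (hU : UniqueDiffOn ℝ S)
    (hω : HasUniformRapidDecayOn S (fun t x => PlanarEigenmode.vorticity (u t) x)) {t : ℝ}
    (ht : t ∈ S) {M : ℝ} (hM : ∀ x, ‖u t x‖ ≤ M)
    (hpos : ∀ x, 0 < PlanarEigenmode.vorticity (u t) x) {L : ℝ} {k : ℕ}
    (hlog : ∀ x, |Real.log (PlanarEigenmode.vorticity (u t) x)| ≤ L * (1 + ‖x‖) ^ k)
    (hsc : ∀ x, ‖fderiv ℝ (PlanarEigenmode.vorticity (u t)) x‖ ≤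
      L * (1 + ‖x‖) ^ k * PlanarEigenmode.vorticity (u t) x) :
    Integrable (fun x => (Real.log (PlanarEigenmode.vorticity (u t) x) + 1) *
        PlanarEigenmode.vorticity (f t) x) (volume : Measure (EuclideanSpace ℝ (Fin 2))) ∧
      ∫ x, (Real.log (PlanarEigenmode.vorticity (u t) x) + 1) *
          timeDerivWithin S (fun s y => PlanarEigenmode.vorticity (u s) y) t x =
        -(ν * ∫ x, ‖fderiv ℝ (PlanarEigenmode.vorticity (u t)) x‖ ^ 2 /
            PlanarEigenmode.vorticity (u t) x) +
          ∫ x, (Real.log (PlanarEigenmode.vorticity (u t) x) + 1) *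
            PlanarEigenmode.vorticity (f t) x := by
  obtain ⟨C, hC, hdec⟩ := exists_planarVorticity_decay h.smooth_velocity hU hω (k + 3)
  have hL : 0 ≤ L := nonneg_of_abs_le_mul_pow hlog
  -- abbreviations and the decay bounds at time `t`
  set w : EuclideanSpace ℝ (Fin 2) → ℝ := PlanarEigenmode.vorticity (u t) with hw
  set wt : EuclideanSpace ℝ (Fin 2) → ℝ :=
    timeDerivWithin S (fun s y => PlanarEigenmode.vorticity (u s) y) t with hwt
  set g : EuclideanSpace ℝ (Fin 2) → ℝ := PlanarEigenmode.vorticity (f t) with hg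
  set φ : EuclideanSpace ℝ (Fin 2) → ℝ := fun x => Real.log (w x) + 1 with hφ
  have h0 : ∀ x, |w x| ≤ C * (1 + ‖x‖) ^ (-((k + 3 : ℕ) : ℝ)) := fun x => (hdec t ht x).1
  have h1 : ∀ x, ‖fderiv ℝ w x‖ ≤ C * (1 + ‖x‖) ^ (-((k + 3 : ℕ) : ℝ)) := fun x => (hdec t ht x).2.1
  have h2 : ∀ x, ‖fderiv ℝ (fderiv ℝ w) x‖ ≤ C * (1 + ‖x‖) ^ (-((k + 3 : ℕ) : ℝ)) := fun x =>
    (hdec t ht x).2.2.1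
  have h3 : ∀ x, |wt x| ≤ C * (1 + ‖x‖) ^ (-((k + 3 : ℕ) : ℝ)) := fun x => (hdec t ht x).2.2.2
  have hwk : ∀ x : EuclideanSpace ℝ (Fin 2), 0 ≤ (1 + ‖x‖) ^ (-((k + 3 : ℕ) : ℝ)) := fun x =>
    Real.rpow_nonneg (by positivity) _
  have hpk : ∀ x : EuclideanSpace ℝ (Fin 2), (1 : ℝ) ≤ (1 + ‖x‖) ^ k := fun x =>
    one_le_pow_one_add_norm x k
  -- regularity of the slices
  have hsm := PlanarEigenmode.isSmoothSpaceTimeOn_vorticity h.smooth_velocity hU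
  have hw2 : ContDiff ℝ 2 w := contDiff_infty.1 (hsm.contDiff_slice ht) 2
  have hw1 : ContDiff ℝ 1 w := contDiff_infty.1 (hsm.contDiff_slice ht) 1
  have hwd : Differentiable ℝ w := hw1.differentiable one_ne_zero
  have hne : ∀ x, w x ≠ 0 := fun x => (hpos x).ne'
  have hu1 : ContDiff ℝ 1 (u t) := contDiff_infty.1 (h.contDiff_velocity ht) 1
  have huc : Continuous (u t) := hu1.continuous
  have hwc : Continuous w := hw1.continuous
  have hDwc : Continuous (fderiv ℝ w) := hw1.continuous_fderiv one_ne_zero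
  have hD2wc : Continuous (fderiv ℝ (fderiv ℝ w)) := hsm.continuous_fderiv_fderiv_slice ht
  have hwtc : Continuous wt := hsm.continuous_timeDerivWithin hU ht
  have hM0 : 0 ≤ M := (norm_nonneg _).trans (hM 0)
  -- the weight `φ = log ω + 1`: regularity and growth
  have hφ1 : ContDiff ℝ 1 φ := (hw1.log hne).add contDiff_const
  have hφc : Continuous φ := hφ1.continuous
  have hφ0 : ∀ x, |φ x| ≤ (L + 1) * (1 + ‖x‖) ^ k := by
    intro x
    calc |φ x| ≤ |Real.log (w x)| + |(1 : ℝ)| := abs_add_le _ _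
      _ ≤ L * (1 + ‖x‖) ^ k + 1 * (1 + ‖x‖) ^ k := by
          rw [abs_one]; exact add_le_add (hlog x) (by rw [one_mul]; exact hpk x)
      _ = (L + 1) * (1 + ‖x‖) ^ k := by ring
  have hDφ : ∀ x, fderiv ℝ φ x = (w x)⁻¹ • fderiv ℝ w x := fderiv_log_eq hwd hpos
  have hDφn : ∀ x, ‖fderiv ℝ φ x‖ ≤ L * (1 + ‖x‖) ^ k := by
    intro x
    rw [hDφ x, norm_smul, Real.norm_eq_abs, abs_inv, abs_of_pos (hpos x), inv_mul_le_iff₀ (hpos x)]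
    calc ‖fderiv ℝ w x‖ ≤ L * (1 + ‖x‖) ^ k * w x := hsc x
      _ = w x * (L * (1 + ‖x‖) ^ k) := mul_comm _ _
  -- the quotient `‖∇ω‖/ω ≤ L (1+‖x‖)^k`
  have hquot : ∀ x, ‖fderiv ℝ w x‖ / w x ≤ L * (1 + ‖x‖) ^ k := fun x => by
    rw [div_le_iff₀ (hpos x)]; exact hsc x
  -- integrability of the pairings
  have hIt : Integrable (fun x => φ x * wt x) (volume : Measure (EuclideanSpace ℝ (Fin 2))) := by
    refine integrable_of_growth_mul_decay₃ (hφc.mul hwtc) (C₁ := L + 1) (C₂ := C) (a := k) fun x => ?_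
    rw [norm_mul, Real.norm_eq_abs, Real.norm_eq_abs]
    exact mul_le_mul (hφ0 x) (h3 x) (abs_nonneg _) (by positivity)
  have hIc : Integrable (fun x => φ x * fderiv ℝ w x (u t x))
      (volume : Measure (EuclideanSpace ℝ (Fin 2))) := by
    refine integrable_of_growth_mul_decay₃ (hφc.mul (hDwc.clm_apply huc)) (C₁ := L + 1)
      (C₂ := C * M) (a := k) fun x => ?_
    rw [norm_mul, Real.norm_eq_abs]
    refine mul_le_mul (hφ0 x) ?_ (norm_nonneg _) (by positivity)
    calc ‖fderiv ℝ w x (u t x)‖ ≤ ‖fderiv ℝ w x‖ * ‖u t x‖ := ContinuousLinearMap.le_opNorm _ _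
      _ ≤ C * (1 + ‖x‖) ^ (-((k + 3 : ℕ) : ℝ)) * M :=
          mul_le_mul (h1 x) (hM x) (norm_nonneg _) (mul_nonneg hC (hwk x))
      _ = C * M * (1 + ‖x‖) ^ (-((k + 3 : ℕ) : ℝ)) := by ring
  have hIΔ : Integrable (fun x => φ x * (Δ w) x) (volume : Measure (EuclideanSpace ℝ (Fin 2))) := by
    refine integrable_of_growth_mul_decay₃ (hφc.mul (continuous_laplacian hw2)) (C₁ := L + 1)
      (C₂ := 2 * C) (a := k) fun x => ?_
    rw [norm_mul, Real.norm_eq_abs]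
    refine mul_le_mul (hφ0 x) ?_ (norm_nonneg _) (by positivity)
    calc ‖(Δ w) x‖ ≤ Module.finrank ℝ (EuclideanSpace ℝ (Fin 2)) * ‖fderiv ℝ (fderiv ℝ w) x‖ :=
          norm_laplacian_le w x
      _ = 2 * ‖fderiv ℝ (fderiv ℝ w) x‖ := by rw [finrank_euclideanSpace_fin]; norm_num
      _ ≤ 2 * (C * (1 + ‖x‖) ^ (-((k + 3 : ℕ) : ℝ))) := by gcongr; exact h2 x
      _ = 2 * C * (1 + ‖x‖) ^ (-((k + 3 : ℕ) : ℝ)) := by ring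
  have hIF : Integrable (fun x => ‖fderiv ℝ w x‖ ^ 2 / w x)
      (volume : Measure (EuclideanSpace ℝ (Fin 2))) := by
    refine integrable_of_growth_mul_decay₃ ((hDwc.norm.pow 2).div hwc hne) (C₁ := L) (C₂ := C)
      (a := k) fun x => ?_
    rw [Real.norm_of_nonneg (div_nonneg (sq_nonneg _) (hpos x).le), sq, mul_div_assoc, mul_comm]
    exact mul_le_mul (hquot x) (h1 x) (norm_nonneg _) (by positivity)
  -- the vorticity equation (2.6), weighted
  have hpt : ∀ x, φ x * g x = φ x * wt x + φ x * fderiv ℝ w x (u t x) - ν * (φ x * (Δ w) x) := by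
    intro x
    have he := h.planarVorticity_eq hU ht x
    rw [convect_apply] at he
    linear_combination (-φ x) * he
  have hIf : Integrable (fun x => φ x * g x) (volume : Measure (EuclideanSpace ℝ (Fin 2))) := by
    have hI : Integrable (fun x => φ x * wt x + φ x * fderiv ℝ w x (u t x) - ν * (φ x * (Δ w) x))
        (volume : Measure (EuclideanSpace ℝ (Fin 2))) := (hIt.add hIc).sub (hIΔ.const_mul ν)
    exact hI.congr (Eventually.of_forall fun x => (hpt x).symm)
  refine ⟨hIf, ?_⟩
  -- (a) the transport term vanishes: `∫ (log ω + 1) Dω(u) = ∫ D(ω log ω)(u) = 0`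
  have hT1 : ∫ x, φ x * fderiv ℝ w x (u t x) = 0 := by
    set θ : EuclideanSpace ℝ (Fin 2) → ℝ := fun y => w y * Real.log (w y) with hθ
    have hθ1 : ContDiff ℝ 1 θ := hw1.mul (hw1.log hne)
    have hDθ : ∀ x, fderiv ℝ θ x = φ x • fderiv ℝ w x := fderiv_mul_log_eq hwd hpos
    have hθ0 : ∀ x, |θ x| ≤ (L + 1) * C * (1 + ‖x‖) ^
        (-((0 + (Module.finrank ℝ (EuclideanSpace ℝ (Fin 2)) + 1) : ℕ) : ℝ)) := by
      intro x
      rw [weightExp_eq_three, hθ, abs_mul, mul_comm]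
      calc |Real.log (w x)| * |w x|
          ≤ L * (1 + ‖x‖) ^ k * (C * (1 + ‖x‖) ^ (-((k + 3 : ℕ) : ℝ))) :=
            mul_le_mul (hlog x) (h0 x) (abs_nonneg _) (by positivity)
        _ = L * C * ((1 + ‖x‖) ^ k * (1 + ‖x‖) ^ (-((k + 3 : ℕ) : ℝ))) := by ring
        _ = L * C * (1 + ‖x‖) ^ (-((3 : ℕ) : ℝ)) := by rw [pow_mul_rpow_neg_add]
        _ ≤ (L + 1) * C * (1 + ‖x‖) ^ (-((3 : ℕ) : ℝ)) := by gcongr; linarith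
        _ = (L + 1) * C * (1 + ‖x‖) ^ (-(3 : ℝ)) := by norm_num
    have hθ1' : ∀ x, ‖fderiv ℝ θ x‖ ≤ (L + 1) * C * (1 + ‖x‖) ^
        (-((0 + (Module.finrank ℝ (EuclideanSpace ℝ (Fin 2)) + 1) : ℕ) : ℝ)) := by
      intro x
      rw [weightExp_eq_three, hDθ x, norm_smul, Real.norm_eq_abs]
      calc |φ x| * ‖fderiv ℝ w x‖
          ≤ (L + 1) * (1 + ‖x‖) ^ k * (C * (1 + ‖x‖) ^ (-((k + 3 : ℕ) : ℝ))) :=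
            mul_le_mul (hφ0 x) (h1 x) (norm_nonneg _) (by positivity)
        _ = (L + 1) * C * ((1 + ‖x‖) ^ k * (1 + ‖x‖) ^ (-((k + 3 : ℕ) : ℝ))) := by ring
        _ = (L + 1) * C * (1 + ‖x‖) ^ (-((3 : ℕ) : ℝ)) := by rw [pow_mul_rpow_neg_add]
        _ = (L + 1) * C * (1 + ‖x‖) ^ (-(3 : ℝ)) := by norm_num
    have key := integral_mul_fderiv_apply_eq_neg_of_decay (v := u t) (θ := θ) (φ := fun _ => (1 : ℝ))
      hu1 hθ1 contDiff_const (h.divFree t ht) hM (Cφ := 1) (k := 0) (fun x => by simp)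
      (fun x => by simp [gradient_fun_const]) hθ0 hθ1'
    simp only [gradient_fun_const, inner_zero_right, mul_zero, integral_zero, neg_zero, one_mul] at key
    rw [← key]
    refine integral_congr_ae (Eventually.of_forall fun x => ?_)
    simp only [hDθ x, FunLike.coe_smul, Pi.smul_apply, smul_eq_mul]
  -- (b) the viscous term: `∫ (log ω + 1) Δω = −∫ ‖∇ω‖²/ω` (coordinatewise integration by parts)
  have hT2 : ∫ x, φ x * (Δ w) x = -∫ x, ‖fderiv ℝ w x‖ ^ 2 / w x := by
    set b := stdOrthonormalBasis ℝ (EuclideanSpace ℝ (Fin 2)) with hb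
    have hD2 : ContDiff ℝ 1 (fderiv ℝ w) := hw2.fderiv_right (m := 1) (by norm_num)
    have hf : ∀ i x, HasFDerivAt (fun y => fderiv ℝ w y (b i))
        ((ContinuousLinearMap.apply ℝ ℝ (b i)).comp (fderiv ℝ (fderiv ℝ w) x)) x :=
      fun i x => (ContinuousLinearMap.apply ℝ ℝ (b i)).hasFDerivAt.comp x
        (hD2.differentiable one_ne_zero x).hasFDerivAt
    -- integrability of the three products
    have hI1 : ∀ i, Integrable (fun x => fderiv ℝ (fderiv ℝ w) x (b i) (b i) * φ x)
        (volume : Measure (EuclideanSpace ℝ (Fin 2))) := by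
      intro i
      refine integrable_of_growth_mul_decay₃
        (((hD2wc.clm_apply continuous_const).clm_apply continuous_const).mul hφc) (C₁ := L + 1)
        (C₂ := C) (a := k) fun x => ?_
      rw [norm_mul, mul_comm]
      refine mul_le_mul (hφ0 x) ?_ (norm_nonneg _) (by positivity)
      exact ((norm_apply_orthonormalBasis_le b i _).trans (norm_apply_orthonormalBasis_le b i _)).trans
        (h2 x)
    have hI2 : ∀ i, Integrable (fun x => fderiv ℝ w x (b i) * fderiv ℝ φ x (b i))
        (volume : Measure (EuclideanSpace ℝ (Fin 2))) := by
      intro i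
      refine integrable_of_growth_mul_decay₃
        ((hDwc.clm_apply continuous_const).mul ((hφ1.continuous_fderiv one_ne_zero).clm_apply
          continuous_const)) (C₁ := L) (C₂ := C) (a := k) fun x => ?_
      rw [norm_mul, mul_comm]
      exact mul_le_mul ((norm_apply_orthonormalBasis_le b i _).trans (hDφn x))
        ((norm_apply_orthonormalBasis_le b i _).trans (h1 x)) (norm_nonneg _) (by positivity)
    have hI3 : ∀ i, Integrable (fun x => fderiv ℝ w x (b i) * φ x)
        (volume : Measure (EuclideanSpace ℝ (Fin 2))) := by
      intro i
      refine integrable_of_growth_mul_decay₃ ((hDwc.clm_apply continuous_const).mul hφc)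
        (C₁ := L + 1) (C₂ := C) (a := k) fun x => ?_
      rw [norm_mul, mul_comm]
      exact mul_le_mul (hφ0 x) ((norm_apply_orthonormalBasis_le b i _).trans (h1 x)) (norm_nonneg _)
        (by positivity)
    -- integration by parts, one coordinate at a time
    have hibp : ∀ i, ∫ x, fderiv ℝ w x (b i) * fderiv ℝ φ x (b i) =
        -∫ x, fderiv ℝ (fderiv ℝ w) x (b i) (b i) * φ x := by
      intro i
      exact integral_bilinear_hasFDerivAt_right_eq_neg_left_of_integrable
        (μ := (volume : Measure (EuclideanSpace ℝ (Fin 2)))) (f := fun y => fderiv ℝ w y (b i))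
        (f' := fun x => (ContinuousLinearMap.apply ℝ ℝ (b i)).comp (fderiv ℝ (fderiv ℝ w) x))
        (g := φ) (g' := fderiv ℝ φ) (v := b i) (B := ContinuousLinearMap.mul ℝ ℝ)
        (hI1 i) (hI2 i) (hI3 i)
        (fun x _ => hf i x) (fun x _ => (hφ1.differentiable one_ne_zero x).hasFDerivAt)
    -- the pointwise identity `∑ᵢ (∂ᵢω)(∂ᵢφ) = ‖∇ω‖²/ω`
    have hsum : ∀ x, ∑ i, fderiv ℝ w x (b i) * fderiv ℝ φ x (b i) = ‖fderiv ℝ w x‖ ^ 2 / w x := by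
      intro x
      simp only [hDφ x, FunLike.coe_smul, Pi.smul_apply, smul_eq_mul]
      rw [b.norm_dual, div_eq_mul_inv, Finset.sum_mul]
      exact Finset.sum_congr rfl fun i _ => by ring
    have hIsum : Integrable (fun x => ∑ i, fderiv ℝ w x (b i) * fderiv ℝ φ x (b i))
        (volume : Measure (EuclideanSpace ℝ (Fin 2))) :=
      integrable_finsetSum _ fun i _ => hI2 i
    calc ∫ x, φ x * (Δ w) x
        = ∫ x, ∑ i, fderiv ℝ (fderiv ℝ w) x (b i) (b i) * φ x := by
          refine integral_congr_ae (Eventually.of_forall fun x => ?_)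
          simp only [laplacian_apply_eq_sum_fderiv_fderiv b, Finset.mul_sum]
          exact Finset.sum_congr rfl fun i _ => mul_comm _ _
      _ = ∑ i, ∫ x, fderiv ℝ (fderiv ℝ w) x (b i) (b i) * φ x :=
          integral_finsetSum _ fun i _ => hI1 i
      _ = -∑ i, ∫ x, fderiv ℝ w x (b i) * fderiv ℝ φ x (b i) := by
          rw [← Finset.sum_neg_distrib]
          refine Finset.sum_congr rfl fun i _ => ?_
          rw [hibp i, neg_neg]
      _ = -∫ x, ∑ i, fderiv ℝ w x (b i) * fderiv ℝ φ x (b i) := by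
          rw [integral_finsetSum _ fun i _ => hI2 i]
      _ = -∫ x, ‖fderiv ℝ w x‖ ^ 2 / w x := by
          congr 1
          exact integral_congr_ae (Eventually.of_forall hsum)
  -- assemble
  have hkey : ∀ x, φ x * wt x =
      -(φ x * fderiv ℝ w x (u t x)) + ν * (φ x * (Δ w) x) + φ x * g x := fun x => by
    rw [hpt x]; ring
  have e1 : ∫ x, φ x * wt x =
      ∫ x, -(φ x * fderiv ℝ w x (u t x)) + ν * (φ x * (Δ w) x) + φ x * g x :=
    integral_congr_ae (Eventually.of_forall hkey)
  have hIn : Integrable (fun x => -(φ x * fderiv ℝ w x (u t x)))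
      (volume : Measure (EuclideanSpace ℝ (Fin 2))) := hIc.neg
  have hIνΔ : Integrable (fun x => ν * (φ x * (Δ w) x))
      (volume : Measure (EuclideanSpace ℝ (Fin 2))) := hIΔ.const_mul ν
  have hI12 : Integrable (fun x => -(φ x * fderiv ℝ w x (u t x)) + ν * (φ x * (Δ w) x))
      (volume : Measure (EuclideanSpace ℝ (Fin 2))) := hIn.add hIνΔ
  rw [e1, integral_add hI12 hIf, integral_add hIn hIνΔ, integral_neg, integral_const_mul, hT1, hT2]
  ring

/-! ### §2 The entropy law within a convex time set -/

/-- **The Boltzmann entropy law (H-theorem of the planar vorticity equation).** On a CONVEX time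
set `S`, for a classical planar solution whose vorticity has uniform rapid decay on `S` and is
POSITIVE and LOG-TAME uniformly on `S` (`|log ω| ≤ L(1+‖x‖)^k`, `‖∇ω‖ ≤ L(1+‖x‖)^k ω` on `S × ℝ²`),
with `u(t)` bounded: `s ↦ ∫ ω(s) log ω(s)` has within `S` at `t` the derivative
`−ν ∫ ‖∇ω(t)‖²/ω(t) + ∫ (log ω(t) + 1) curl f(t)` (differentiation under the integral sign,
dominated by the uniform decay of `∂ₜω` against the tame growth of `log ω`; then §1).
[cite: GallayWayne2005, Lemma 3.2 (proof, p. 12)] -/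
theorem IsClassicalNSSolutionOn.hasDerivWithinAt_integral_mul_log_planarVorticity
    (h : IsClassicalNSSolutionOn S ν f u p) (hS : Convex ℝ S)
    (hω : HasUniformRapidDecayOn S (fun t x => PlanarEigenmode.vorticity (u t) x)) {t : ℝ}
    (ht : t ∈ S) {M : ℝ} (hM : ∀ x, ‖u t x‖ ≤ M)
    (hpos : ∀ s ∈ S, ∀ x, 0 < PlanarEigenmode.vorticity (u s) x) {L : ℝ} {k : ℕ}
    (hlog : ∀ s ∈ S, ∀ x, |Real.log (PlanarEigenmode.vorticity (u s) x)| ≤ L * (1 + ‖x‖) ^ k)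
    (hsc : ∀ s ∈ S, ∀ x, ‖fderiv ℝ (PlanarEigenmode.vorticity (u s)) x‖ ≤
      L * (1 + ‖x‖) ^ k * PlanarEigenmode.vorticity (u s) x) :
    HasDerivWithinAt
      (fun s => ∫ x, PlanarEigenmode.vorticity (u s) x * Real.log (PlanarEigenmode.vorticity (u s) x))
      (-(ν * ∫ x, ‖fderiv ℝ (PlanarEigenmode.vorticity (u t)) x‖ ^ 2 /
            PlanarEigenmode.vorticity (u t) x) +
          ∫ x, (Real.log (PlanarEigenmode.vorticity (u t) x) + 1) *
            PlanarEigenmode.vorticity (f t) x) S t := by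
  -- isolated points of `S`: the statement is empty
  by_cases hacc : AccPt t (𝓟 S)
  swap
  · exact hasDerivWithinAt_iff_hasFDerivWithinAt.2 (HasFDerivWithinAt.of_not_accPt hacc)
  have hU : UniqueDiffOn ℝ S := uniqueDiffOn_of_convex_of_accPt hS ht hacc
  have hsm := PlanarEigenmode.isSmoothSpaceTimeOn_vorticity h.smooth_velocity hU
  obtain ⟨C, hC, hdec⟩ := exists_planarVorticity_decay h.smooth_velocity hU hω (k + 3)
  have hL : 0 ≤ L := nonneg_of_abs_le_mul_pow (hlog t ht)
  have hpk : ∀ x : EuclideanSpace ℝ (Fin 2), (1 : ℝ) ≤ (1 + ‖x‖) ^ k := fun x =>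
    one_le_pow_one_add_norm x k
  -- growth of `log ω + 1`, uniformly on `S`
  have hφ0 : ∀ s ∈ S, ∀ x, |Real.log (PlanarEigenmode.vorticity (u s) x) + 1| ≤
      (L + 1) * (1 + ‖x‖) ^ k := by
    intro s hs x
    calc |Real.log (PlanarEigenmode.vorticity (u s) x) + 1|
        ≤ |Real.log (PlanarEigenmode.vorticity (u s) x)| + |(1 : ℝ)| := abs_add_le _ _
      _ ≤ L * (1 + ‖x‖) ^ k + 1 * (1 + ‖x‖) ^ k := by
          rw [abs_one]; exact add_le_add (hlog s hs x) (by rw [one_mul]; exact hpk x)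
      _ = (L + 1) * (1 + ‖x‖) ^ k := by ring
  -- the dominating function
  set bound : EuclideanSpace ℝ (Fin 2) → ℝ := fun x =>
    (L + 1) * (1 + ‖x‖) ^ k * (C * (1 + ‖x‖) ^ (-((k + 3 : ℕ) : ℝ))) with hbound
  have hbc : Continuous bound := by
    have h1 : Continuous fun x : EuclideanSpace ℝ (Fin 2) => (1 + ‖x‖) := by fun_prop
    exact ((continuous_const.mul (h1.pow k))).mul
      (continuous_const.mul (h1.rpow_const fun x => Or.inl (by positivity)))
  have hbi : Integrable bound (volume : Measure (EuclideanSpace ℝ (Fin 2))) :=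
    integrable_of_growth_mul_decay₃ hbc (C₁ := L + 1) (C₂ := C) (a := k) fun x => by
      rw [Real.norm_of_nonneg (by positivity)]
  -- differentiate under the integral sign within `S`
  have hF_meas : ∀ s ∈ S, AEStronglyMeasurable
      (fun x => PlanarEigenmode.vorticity (u s) x * Real.log (PlanarEigenmode.vorticity (u s) x))
      (volume : Measure (EuclideanSpace ℝ (Fin 2))) := fun s hs =>
    (Real.continuous_mul_log.comp (hsm.continuous_slice hs)).aestronglyMeasurable
  have hF_int : Integrable
      (fun x => PlanarEigenmode.vorticity (u t) x * Real.log (PlanarEigenmode.vorticity (u t) x))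
      (volume : Measure (EuclideanSpace ℝ (Fin 2))) := by
    refine integrable_of_growth_mul_decay₃ (Real.continuous_mul_log.comp (hsm.continuous_slice ht))
      (C₁ := L) (C₂ := C) (a := k) fun x => ?_
    rw [norm_mul, Real.norm_eq_abs, Real.norm_eq_abs, mul_comm]
    exact mul_le_mul (hlog t ht x) ((hdec t ht x).1) (abs_nonneg _) (by positivity)
  have h_bound : ∀ s ∈ S, ∀ x,
      ‖(Real.log (PlanarEigenmode.vorticity (u s) x) + 1) *
        timeDerivWithin S (fun r y => PlanarEigenmode.vorticity (u r) y) s x‖ ≤ bound x := by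
    intro s hs x
    rw [hbound, norm_mul, Real.norm_eq_abs, Real.norm_eq_abs]
    exact mul_le_mul (hφ0 s hs x) (hdec s hs x).2.2.2 (abs_nonneg _) (by positivity)
  have h_diff : ∀ s ∈ S, ∀ x, HasDerivWithinAt
      (fun r => PlanarEigenmode.vorticity (u r) x * Real.log (PlanarEigenmode.vorticity (u r) x))
      ((Real.log (PlanarEigenmode.vorticity (u s) x) + 1) *
        timeDerivWithin S (fun r y => PlanarEigenmode.vorticity (u r) y) s x) S s := by
    intro s hs x
    have h1 := hsm.hasDerivWithinAt_timeDerivWithin hU hs x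
    have h2 := (Real.hasDerivAt_mul_log (hpos s hs x).ne').comp_hasDerivWithinAt s h1
    exact h2
  have hD := hasDerivWithinAt_integral_of_dominated_convex hS ht
    (F := fun s x => PlanarEigenmode.vorticity (u s) x * Real.log (PlanarEigenmode.vorticity (u s) x))
    (F' := fun s x => (Real.log (PlanarEigenmode.vorticity (u s) x) + 1) *
      timeDerivWithin S (fun r y => PlanarEigenmode.vorticity (u r) y) s x)
    hF_meas hF_int h_bound hbi h_diff
  exact hD.congr_deriv (h.integral_log_mul_timeDerivWithin_planarVorticity_eq hU hω ht hM
    (hpos t ht) (hlog t ht) (hsc t ht)).2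

/-! ### §3 The spreading Gaussian and the relative entropy -/

/-- The Gaussian integral on `ℝ²`: `∫ exp(−‖x‖²/(4νT)) dx = 4πνT` (`ν, T > 0`), and integrability.
[folklore] -/
private theorem integral_exp_neg_sq_div {ν T : ℝ} (hν : 0 < ν) (hT : 0 < T) :
    Integrable (fun x : EuclideanSpace ℝ (Fin 2) => Real.exp (-(‖x‖ ^ 2 / (4 * ν * T))))
        (volume : Measure (EuclideanSpace ℝ (Fin 2))) ∧
      ∫ x : EuclideanSpace ℝ (Fin 2), Real.exp (-(‖x‖ ^ 2 / (4 * ν * T))) = 4 * Real.pi * ν * T := by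
  have hb : (0 : ℝ) < (4 * ν * T)⁻¹ := by positivity
  have h := GaussianFourier.integral_rexp_neg_mul_sq_norm (V := EuclideanSpace ℝ (Fin 2)) hb
  have e : (fun x : EuclideanSpace ℝ (Fin 2) => Real.exp (-(‖x‖ ^ 2 / (4 * ν * T)))) =
      fun x => Real.exp (-(4 * ν * T)⁻¹ * ‖x‖ ^ 2) := by
    funext x; congr 1; rw [div_eq_inv_mul, neg_mul]
  rw [finrank_euclideanSpace_fin] at h
  have hval : (Real.pi / (4 * ν * T)⁻¹) ^ ((2 : ℕ) / 2 : ℝ) = 4 * Real.pi * ν * T := by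
    rw [show ((2 : ℕ) / 2 : ℝ) = 1 by norm_num, Real.rpow_one, div_inv_eq_mul]; ring
  rw [hval] at h
  rw [e]
  refine ⟨?_, h⟩
  by_contra hni
  rw [integral_undef hni] at h
  have : (0 : ℝ) < 4 * Real.pi * ν * T := by positivity
  linarith

/-- The spreading Gaussian of mass `Γ`: positivity, integrability, `∫ g = Γ`, and its logarithm
`log g(x) = log(Γ/(4πνT)) − ‖x‖²/(4νT)`. [folklore] -/
private theorem gaussian_facts {Γ ν T : ℝ} (hΓ : 0 < Γ) (hν : 0 < ν) (hT : 0 < T) :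
    (∀ x : EuclideanSpace ℝ (Fin 2), 0 < Γ / (4 * Real.pi * ν * T) * Real.exp (-(‖x‖ ^ 2 / (4 * ν * T)))) ∧
      Integrable (fun x : EuclideanSpace ℝ (Fin 2) =>
        Γ / (4 * Real.pi * ν * T) * Real.exp (-(‖x‖ ^ 2 / (4 * ν * T))))
        (volume : Measure (EuclideanSpace ℝ (Fin 2))) ∧
      (∫ x : EuclideanSpace ℝ (Fin 2), Γ / (4 * Real.pi * ν * T) * Real.exp (-(‖x‖ ^ 2 / (4 * ν * T))) = Γ) ∧
      ∀ x : EuclideanSpace ℝ (Fin 2),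
        Real.log (Γ / (4 * Real.pi * ν * T) * Real.exp (-(‖x‖ ^ 2 / (4 * ν * T)))) =
          Real.log (Γ / (4 * Real.pi * ν * T)) - ‖x‖ ^ 2 / (4 * ν * T) := by
  obtain ⟨hi, hval⟩ := integral_exp_neg_sq_div hν hT
  have hc : 0 < Γ / (4 * Real.pi * ν * T) := by positivity
  refine ⟨fun x => mul_pos hc (Real.exp_pos _), hi.const_mul _, ?_, fun x => ?_⟩
  · rw [integral_const_mul, hval]; field_simp
  · rw [Real.log_mul hc.ne' (Real.exp_pos _).ne', Real.log_exp]; ring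

/-- **Splitting the relative entropy.** For a positive continuous `w` on `ℝ²` with `w`, `‖x‖² w`,
`w log w ∈ L¹`, and the Gaussian `g = Γ (4πνT)⁻¹ e^{−‖x‖²/(4νT)}` (`Γ, ν, T > 0`): `w log (w/g) ∈ L¹` and
`∫ w log (w/g) = ∫ w log w + (∫ ‖x‖² w)/(4νT) + log(4πνT/Γ) ∫ w`. [folklore] -/
private theorem integral_mul_log_div_gaussian_eq {w : EuclideanSpace ℝ (Fin 2) → ℝ}
    (hpos : ∀ x, 0 < w x) (hi : Integrable w (volume : Measure (EuclideanSpace ℝ (Fin 2))))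
    (hi2 : Integrable (fun x => ‖x‖ ^ 2 * w x) (volume : Measure (EuclideanSpace ℝ (Fin 2))))
    (hilog : Integrable (fun x => w x * Real.log (w x)) (volume : Measure (EuclideanSpace ℝ (Fin 2))))
    {Γ ν T : ℝ} (hΓ : 0 < Γ) (hν : 0 < ν) (hT : 0 < T) :
    Integrable (fun x => w x * Real.log (w x /
        (Γ / (4 * Real.pi * ν * T) * Real.exp (-(‖x‖ ^ 2 / (4 * ν * T))))))
        (volume : Measure (EuclideanSpace ℝ (Fin 2))) ∧
      ∫ x, w x * Real.log (w x / (Γ / (4 * Real.pi * ν * T) * Real.exp (-(‖x‖ ^ 2 / (4 * ν * T))))) =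
        (∫ x, w x * Real.log (w x)) + (∫ x, ‖x‖ ^ 2 * w x) / (4 * ν * T) +
          Real.log (4 * Real.pi * ν * T / Γ) * ∫ x, w x := by
  obtain ⟨hgpos, -, -, hlogg⟩ := gaussian_facts hΓ hν hT
  have hpt : ∀ x, w x * Real.log (w x /
      (Γ / (4 * Real.pi * ν * T) * Real.exp (-(‖x‖ ^ 2 / (4 * ν * T))))) =
      w x * Real.log (w x) + (‖x‖ ^ 2 * w x) / (4 * ν * T) +
        Real.log (4 * Real.pi * ν * T / Γ) * w x := by
    intro x
    rw [Real.log_div (hpos x).ne' (hgpos x).ne', hlogg x]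
    have e : Real.log (4 * Real.pi * ν * T / Γ) = -Real.log (Γ / (4 * Real.pi * ν * T)) := by
      rw [← Real.log_inv, inv_div]
    rw [e]
    ring
  have hI : Integrable (fun x => w x * Real.log (w x) + (‖x‖ ^ 2 * w x) / (4 * ν * T) +
      Real.log (4 * Real.pi * ν * T / Γ) * w x) (volume : Measure (EuclideanSpace ℝ (Fin 2))) :=
    (hilog.add (hi2.div_const _)).add (hi.const_mul _)
  refine ⟨hI.congr (Eventually.of_forall fun x => (hpt x).symm), ?_⟩
  rw [integral_congr_ae (Eventually.of_forall hpt)]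
  have i1 : Integrable (fun x => (‖x‖ ^ 2 * w x) / (4 * ν * T))
      (volume : Measure (EuclideanSpace ℝ (Fin 2))) := hi2.div_const _
  have i2 : Integrable (fun x => Real.log (4 * Real.pi * ν * T / Γ) * w x)
      (volume : Measure (EuclideanSpace ℝ (Fin 2))) := hi.const_mul _
  have i3 : Integrable (fun x => w x * Real.log (w x) + (‖x‖ ^ 2 * w x) / (4 * ν * T))
      (volume : Measure (EuclideanSpace ℝ (Fin 2))) := hilog.add i1
  rw [integral_add i3 i2, integral_add hilog i1, integral_div, integral_const_mul]

/-- The vorticity slice of a classical planar solution is `C¹` (no unique differentiability of the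
time set needed). [folklore] -/
private theorem contDiff_planarVorticity_slice (h : IsClassicalNSSolutionOn S ν f u p) {s : ℝ}
    (hs : s ∈ S) : ContDiff ℝ 1 (PlanarEigenmode.vorticity (u s)) := by
  have hu2 : ContDiff ℝ 2 (u s) := contDiff_infty.1 (h.contDiff_velocity hs) 2
  have hD : ContDiff ℝ 1 (fderiv ℝ (u s)) := hu2.fderiv_right (m := 1) (by norm_num)
  have e : PlanarEigenmode.vorticity (u s) = fun z =>
      fderiv ℝ (u s) z (EuclideanSpace.single 0 1) 1 - fderiv ℝ (u s) z (EuclideanSpace.single 1 1) 0 := rfl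
  rw [e]
  exact (contDiff_euclidean.1 (hD.clm_apply contDiff_const) 1).sub
    (contDiff_euclidean.1 (hD.clm_apply contDiff_const) 0)

/-- The basic slice facts of the log-tame positive class (no unique differentiability needed): at
every `s ∈ S`, `ω(s)` is `C¹`, integrable with `∫ ω(s) > 0`, and `‖x‖² ω(s)`, `ω log ω ∈ L¹`.
[folklore] -/
private theorem slice_basic (h : IsClassicalNSSolutionOn S ν f u p)
    (hω : HasUniformRapidDecayOn S (fun t x => PlanarEigenmode.vorticity (u t) x))
    (hpos : ∀ s ∈ S, ∀ x, 0 < PlanarEigenmode.vorticity (u s) x) {L : ℝ} {k : ℕ}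
    (hlog : ∀ s ∈ S, ∀ x, |Real.log (PlanarEigenmode.vorticity (u s) x)| ≤ L * (1 + ‖x‖) ^ k)
    {s : ℝ} (hs : s ∈ S) :
    ContDiff ℝ 1 (PlanarEigenmode.vorticity (u s)) ∧
      Integrable (PlanarEigenmode.vorticity (u s)) (volume : Measure (EuclideanSpace ℝ (Fin 2))) ∧
      (0 < ∫ x, PlanarEigenmode.vorticity (u s) x) ∧
      Integrable (fun x => ‖x‖ ^ 2 * PlanarEigenmode.vorticity (u s) x)
        (volume : Measure (EuclideanSpace ℝ (Fin 2))) ∧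
      Integrable (fun x => PlanarEigenmode.vorticity (u s) x * Real.log (PlanarEigenmode.vorticity (u s) x))
        (volume : Measure (EuclideanSpace ℝ (Fin 2))) ∧
      ∀ x, |PlanarEigenmode.vorticity (u s) x| ≤ Classical.choose (hω.norm_le_rpow ((k + 2) + 3)) := by
  obtain ⟨hC, hdec⟩ := Classical.choose_spec (hω.norm_le_rpow ((k + 2) + 3))
  set C := Classical.choose (hω.norm_le_rpow ((k + 2) + 3)) with hCdef
  set w : EuclideanSpace ℝ (Fin 2) → ℝ := PlanarEigenmode.vorticity (u s) with hw
  have h0 : ∀ x, |w x| ≤ C * (1 + ‖x‖) ^ (-(((k + 2) + 3 : ℕ) : ℝ)) := fun x => by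
    have h := hdec s hs x
    rwa [Real.norm_eq_abs] at h
  have hw1 : ContDiff ℝ 1 w := contDiff_planarVorticity_slice h hs
  have hwc : Continuous w := hw1.continuous
  have hne : ∀ x, w x ≠ 0 := fun x => (hpos s hs x).ne'
  have hx1 : ∀ x : EuclideanSpace ℝ (Fin 2), (0 : ℝ) ≤ 1 + ‖x‖ := fun x => by positivity
  have hpk : ∀ x : EuclideanSpace ℝ (Fin 2), (1 + ‖x‖) ^ k ≤ (1 + ‖x‖) ^ (k + 2) := fun x =>
    pow_le_pow_right₀ (by linarith [norm_nonneg x]) (by omega)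
  obtain ⟨hi, hbdd⟩ := integrable_and_bounded_of_decay hwc hC h0
  refine ⟨hw1, hi, ?_, ?_, ?_, hbdd⟩
  · rw [integral_pos_iff_support_of_nonneg (fun x => (hpos s hs x).le) hi]
    have hsupp : Function.support w = univ := by
      ext x; simp [Function.mem_support, hne x]
    rw [hsupp]
    simp
  · refine integrable_of_growth_mul_decay₃ ((continuous_norm.pow 2).mul hwc) (C₁ := 1) (C₂ := C)
      (a := k + 2) fun x => ?_
    rw [norm_mul, norm_pow, norm_norm, Real.norm_eq_abs, one_mul]
    refine mul_le_mul ?_ (h0 x) (abs_nonneg _) (pow_nonneg (hx1 x) _)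
    calc ‖x‖ ^ 2 ≤ (1 + ‖x‖) ^ 2 := by gcongr; linarith [norm_nonneg x]
      _ ≤ (1 + ‖x‖) ^ (k + 2) := pow_le_pow_right₀ (by linarith [norm_nonneg x]) (by omega)
  · refine integrable_of_growth_mul_decay₃ (Real.continuous_mul_log.comp hwc) (C₁ := L) (C₂ := C)
      (a := k + 2) fun x => ?_
    rw [norm_mul, Real.norm_eq_abs, Real.norm_eq_abs, mul_comm]
    refine mul_le_mul ((hlog s hs x).trans ?_) (h0 x) (abs_nonneg _) ?_
    · exact mul_le_mul_of_nonneg_left (hpk x) (nonneg_of_abs_le_mul_pow (hlog s hs))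
    · exact mul_nonneg (nonneg_of_abs_le_mul_pow (hlog s hs)) (pow_nonneg (hx1 x) _)

/-- The slice toolkit of the log-tame positive class: at every `s ∈ S`, `ω(s)` is `C¹`, integrable
with `∫ ω(s) > 0`, `‖x‖² ω(s)`, `ω log ω`, `‖∇ω‖²/ω ∈ L¹`, and `u(s) = K₂ ∗ ω(s)` is bounded. [folklore] -/
private theorem slice_toolkit (h : IsClassicalNSSolutionOn S ν f u p) (hU : UniqueDiffOn ℝ S)
    (hω : HasUniformRapidDecayOn S (fun t x => PlanarEigenmode.vorticity (u t) x))
    (hBS : ∀ s ∈ S, ∀ x, u s x = biotSavart2D (PlanarEigenmode.vorticity (u s)) x)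
    (hpos : ∀ s ∈ S, ∀ x, 0 < PlanarEigenmode.vorticity (u s) x) {L : ℝ} {k : ℕ}
    (hlog : ∀ s ∈ S, ∀ x, |Real.log (PlanarEigenmode.vorticity (u s) x)| ≤ L * (1 + ‖x‖) ^ k)
    (hsc : ∀ s ∈ S, ∀ x, ‖fderiv ℝ (PlanarEigenmode.vorticity (u s)) x‖ ≤
      L * (1 + ‖x‖) ^ k * PlanarEigenmode.vorticity (u s) x) {s : ℝ} (hs : s ∈ S) :
    ContDiff ℝ 1 (PlanarEigenmode.vorticity (u s)) ∧
      Integrable (PlanarEigenmode.vorticity (u s)) (volume : Measure (EuclideanSpace ℝ (Fin 2))) ∧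
      (0 < ∫ x, PlanarEigenmode.vorticity (u s) x) ∧
      Integrable (fun x => ‖x‖ ^ 2 * PlanarEigenmode.vorticity (u s) x)
        (volume : Measure (EuclideanSpace ℝ (Fin 2))) ∧
      Integrable (fun x => PlanarEigenmode.vorticity (u s) x * Real.log (PlanarEigenmode.vorticity (u s) x))
        (volume : Measure (EuclideanSpace ℝ (Fin 2))) ∧
      Integrable (fun x => ‖fderiv ℝ (PlanarEigenmode.vorticity (u s)) x‖ ^ 2 /
        PlanarEigenmode.vorticity (u s) x) (volume : Measure (EuclideanSpace ℝ (Fin 2))) ∧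
      ∃ M : ℝ, ∀ x, ‖u s x‖ ≤ M := by
  obtain ⟨hw1, hi, hipos, hi2, hilog, hbdd⟩ := slice_basic h hω hpos hlog (k := k) hs
  obtain ⟨C, hC, hdec⟩ := exists_planarVorticity_decay h.smooth_velocity hU hω ((k + 2) + 3)
  set w : EuclideanSpace ℝ (Fin 2) → ℝ := PlanarEigenmode.vorticity (u s) with hw
  have h1 : ∀ x, ‖fderiv ℝ w x‖ ≤ C * (1 + ‖x‖) ^ (-(((k + 2) + 3 : ℕ) : ℝ)) := fun x =>
    (hdec s hs x).2.1
  have hwc : Continuous w := hw1.continuous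
  have hDwc : Continuous (fderiv ℝ w) := hw1.continuous_fderiv one_ne_zero
  have hne : ∀ x, w x ≠ 0 := fun x => (hpos s hs x).ne'
  have hx1 : ∀ x : EuclideanSpace ℝ (Fin 2), (0 : ℝ) ≤ 1 + ‖x‖ := fun x => by positivity
  have hpk : ∀ x : EuclideanSpace ℝ (Fin 2), (1 + ‖x‖) ^ k ≤ (1 + ‖x‖) ^ (k + 2) := fun x =>
    pow_le_pow_right₀ (by linarith [norm_nonneg x]) (by omega)
  refine ⟨hw1, hi, hipos, hi2, hilog, ?_, exists_norm_le_of_eq_biotSavart2D hi hbdd (hBS s hs)⟩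
  refine integrable_of_growth_mul_decay₃ ((hDwc.norm.pow 2).div hwc hne) (C₁ := L) (C₂ := C)
    (a := k + 2) fun x => ?_
  rw [Real.norm_of_nonneg (div_nonneg (sq_nonneg _) (hpos s hs x).le), sq, mul_div_assoc, mul_comm]
  refine mul_le_mul ?_ (h1 x) (norm_nonneg _) ?_
  · rw [div_le_iff₀ (hpos s hs x)]
    calc ‖fderiv ℝ w x‖ ≤ L * (1 + ‖x‖) ^ k * w x := hsc s hs x
      _ ≤ L * (1 + ‖x‖) ^ (k + 2) * w x :=
          mul_le_mul_of_nonneg_right (mul_le_mul_of_nonneg_left (hpk x)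
            (nonneg_of_abs_le_mul_pow (hlog s hs))) (hpos s hs x).le
  · exact mul_nonneg (nonneg_of_abs_le_mul_pow (hlog s hs)) (pow_nonneg (hx1 x) _)

/-- A convex set of times containing two distinct points has unique differentiability. [folklore] -/
private theorem uniqueDiffOn_of_convex_of_lt (hS : Convex ℝ S) {t₀ t : ℝ} (ht₀ : t₀ ∈ S)
    (ht : t ∈ S) (hlt : t₀ < t) : UniqueDiffOn ℝ S := by
  refine uniqueDiffOn_convex hS ⟨(t + t₀) / 2, interior_mono (hS.ordConnected.out ht₀ ht) ?_⟩
  rw [interior_Icc]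
  exact ⟨by linarith, by linarith⟩

/-- The derivative of the REDUCED relative entropy
`s ↦ ∫ ω log ω + (∫‖x‖²ω)/(4νT(s)) + Γ log(4πνT(s)/Γ)` within `S` at `t` (`T(t) > 0`):
`−ν ∫‖∇ω‖²/ω + 2Γ/T − (∫‖x‖²ω)/(4νT²)` (entropy law §2, moment laws, chain rule). [folklore] -/
private theorem hasDerivWithinAt_relEntropyRed
    (h : IsClassicalNSSolutionOn S ν f u p) (hS : Convex ℝ S) (hU : UniqueDiffOn ℝ S) (hν : 0 < ν)
    (hω : HasUniformRapidDecayOn S (fun t x => PlanarEigenmode.vorticity (u t) x))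
    (hBS : ∀ s ∈ S, ∀ x, u s x = biotSavart2D (PlanarEigenmode.vorticity (u s)) x)
    (hcurl : ∀ s ∈ S, ∀ x, PlanarEigenmode.vorticity (f s) x = 0)
    (hpos : ∀ s ∈ S, ∀ x, 0 < PlanarEigenmode.vorticity (u s) x) {L : ℝ} {k : ℕ}
    (hlog : ∀ s ∈ S, ∀ x, |Real.log (PlanarEigenmode.vorticity (u s) x)| ≤ L * (1 + ‖x‖) ^ k)
    (hsc : ∀ s ∈ S, ∀ x, ‖fderiv ℝ (PlanarEigenmode.vorticity (u s)) x‖ ≤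
      L * (1 + ‖x‖) ^ k * PlanarEigenmode.vorticity (u s) x)
    {t₀ t tstar : ℝ} (ht₀ : t₀ ∈ S) (ht : t ∈ S) (hTt : 0 < t - t₀ + tstar) :
    HasDerivWithinAt
      (fun s => (∫ x, PlanarEigenmode.vorticity (u s) x * Real.log (PlanarEigenmode.vorticity (u s) x)) +
        (∫ x, ‖x‖ ^ 2 * PlanarEigenmode.vorticity (u s) x) / (4 * ν * (s - t₀ + tstar)) +
          (∫ y, PlanarEigenmode.vorticity (u t₀) y) *
            Real.log (4 * Real.pi * ν * (s - t₀ + tstar) / ∫ y, PlanarEigenmode.vorticity (u t₀) y))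
      (-(ν * ∫ x, ‖fderiv ℝ (PlanarEigenmode.vorticity (u t)) x‖ ^ 2 /
            PlanarEigenmode.vorticity (u t) x) +
          2 * (∫ y, PlanarEigenmode.vorticity (u t₀) y) / (t - t₀ + tstar) -
          (∫ x, ‖x‖ ^ 2 * PlanarEigenmode.vorticity (u t) x) / (4 * ν * (t - t₀ + tstar) ^ 2)) S t := by
  set Γ : ℝ := ∫ y, PlanarEigenmode.vorticity (u t₀) y with hΓdef
  obtain ⟨-, -, -, -, -, -, M, hM⟩ := slice_toolkit h hU hω hBS hpos hlog hsc ht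
  obtain ⟨-, -, hΓpos, -⟩ := slice_toolkit h hU hω hBS hpos hlog hsc ht₀
  -- conservation of the circulation on `S`
  have hΓs : ∀ s ∈ S, ∫ y, PlanarEigenmode.vorticity (u s) y = Γ := fun s hs =>
    (h.planarVorticity_moments_eq hS hω hBS hcurl ht₀ hs 0).1
  -- the three laws at `t`
  have hSd := h.hasDerivWithinAt_integral_mul_log_planarVorticity hS hω ht hM hpos hlog hsc
  simp_rw [hcurl t ht, mul_zero, integral_zero, add_zero] at hSd
  have hM₂d := h.hasDerivWithinAt_integral_norm_sq_mul_planarVorticity hS hω ht (hBS t ht)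
  simp_rw [hcurl t ht, mul_zero, integral_zero, add_zero] at hM₂d
  rw [hΓs t ht] at hM₂d
  have hTd : HasDerivWithinAt (fun s => s - t₀ + tstar) 1 S t :=
    ((hasDerivWithinAt_id t S).sub_const t₀).add_const tstar
  have hquot := hM₂d.div (hTd.const_mul (4 * ν)) (by positivity)
  have hlogd := ((hTd.const_mul (4 * Real.pi * ν)).div_const Γ).log (by positivity)
  refine ((hSd.add hquot).add (hlogd.const_mul Γ)).congr_deriv ?_
  field_simp
  ring

/-- **Gallay–Wayne's entropy dissipation law (Lemma 3.2) in physical variables.** On a convex time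
set `S`, let a classical planar solution have curl-free force, Biot–Savart velocity
`u(s) = K₂ ∗ ω(s)`, a vorticity with uniform rapid decay which is positive and log-tame on `S`
(`|log ω| ≤ L(1+‖x‖)^k`, `‖∇ω‖ ≤ L(1+‖x‖)^k ω`); fix `t₀ ∈ S`, a virtual time origin `t⋆ > 0`, put
`T(s) = s − t₀ + t⋆`, `Γ = ∫ ω(t₀)`, and let `g_s = Γ (4πνT(s))⁻¹ e^{−‖x‖²/(4νT(s))}` be the spreading
Gaussian of the same circulation. Then at every `t ∈ S` with `t₀ ≤ t` the relative entropy
`H(s) = ∫ ω(s) log (ω(s)/g_s)` has within `S` the derivative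
`−ν ∫ ‖∇ω(t)‖²/ω(t) + 2Γ/T(t) − (∫ ‖x‖² ω(t))/(4ν T(t)²)`, which is `−ν ∫ ω ‖∇ log(ω/g_t)‖²`
expanded (`∫ ⟪∇ω, x⟫ = −2Γ`) — Gallay–Wayne's `dH/dτ = −I(w)` under `e^{τ} = T/t⋆` — from the
Boltzmann entropy law (§2) and Majda–Bertozzi's moment laws `dΓ/dt = 0`, `d/dt ∫‖x‖²ω = 4νΓ`.
[cite: GallayWayne2005, Lemma 3.2 (proof, p. 12); MajdaBertozziCUP2002, §1.7 Prop. 1.14] -/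
theorem IsClassicalNSSolutionOn.hasDerivWithinAt_relEntropy_planarVorticity
    (h : IsClassicalNSSolutionOn S ν f u p) (hS : Convex ℝ S) (hν : 0 < ν)
    (hω : HasUniformRapidDecayOn S (fun t x => PlanarEigenmode.vorticity (u t) x))
    (hBS : ∀ s ∈ S, ∀ x, u s x = biotSavart2D (PlanarEigenmode.vorticity (u s)) x)
    (hcurl : ∀ s ∈ S, ∀ x, PlanarEigenmode.vorticity (f s) x = 0)
    (hpos : ∀ s ∈ S, ∀ x, 0 < PlanarEigenmode.vorticity (u s) x) {L : ℝ} {k : ℕ}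
    (hlog : ∀ s ∈ S, ∀ x, |Real.log (PlanarEigenmode.vorticity (u s) x)| ≤ L * (1 + ‖x‖) ^ k)
    (hsc : ∀ s ∈ S, ∀ x, ‖fderiv ℝ (PlanarEigenmode.vorticity (u s)) x‖ ≤
      L * (1 + ‖x‖) ^ k * PlanarEigenmode.vorticity (u s) x)
    {t₀ t tstar : ℝ} (ht₀ : t₀ ∈ S) (ht : t ∈ S) (hle : t₀ ≤ t) (htstar : 0 < tstar) :
    HasDerivWithinAt
      (fun s => ∫ x, PlanarEigenmode.vorticity (u s) x * Real.log (PlanarEigenmode.vorticity (u s) x /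
        ((∫ y, PlanarEigenmode.vorticity (u t₀) y) / (4 * Real.pi * ν * (s - t₀ + tstar)) *
          Real.exp (-(‖x‖ ^ 2 / (4 * ν * (s - t₀ + tstar)))))))
      (-(ν * ∫ x, ‖fderiv ℝ (PlanarEigenmode.vorticity (u t)) x‖ ^ 2 /
            PlanarEigenmode.vorticity (u t) x) +
          2 * (∫ y, PlanarEigenmode.vorticity (u t₀) y) / (t - t₀ + tstar) -
          (∫ x, ‖x‖ ^ 2 * PlanarEigenmode.vorticity (u t) x) / (4 * ν * (t - t₀ + tstar) ^ 2)) S t := by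
  -- isolated points of `S`: the statement is empty
  by_cases hacc : AccPt t (𝓟 S)
  swap
  · exact hasDerivWithinAt_iff_hasFDerivWithinAt.2 (HasFDerivWithinAt.of_not_accPt hacc)
  have hU : UniqueDiffOn ℝ S := uniqueDiffOn_of_convex_of_accPt hS ht hacc
  set Γ : ℝ := ∫ y, PlanarEigenmode.vorticity (u t₀) y with hΓdef
  have hTt : 0 < t - t₀ + tstar := by linarith
  obtain ⟨-, -, hΓpos, -⟩ := slice_toolkit h hU hω hBS hpos hlog hsc ht₀
  have hΓs : ∀ s ∈ S, ∫ y, PlanarEigenmode.vorticity (u s) y = Γ := fun s hs =>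
    (h.planarVorticity_moments_eq hS hω hBS hcurl ht₀ hs 0).1
  have hred := hasDerivWithinAt_relEntropyRed h hS hU hν hω hBS hcurl hpos hlog hsc ht₀ ht hTt
  -- `H = reduced expression` near `t` within `S`
  have hsplit : ∀ s ∈ S, 0 < s - t₀ + tstar →
      ∫ x, PlanarEigenmode.vorticity (u s) x * Real.log (PlanarEigenmode.vorticity (u s) x /
        (Γ / (4 * Real.pi * ν * (s - t₀ + tstar)) * Real.exp (-(‖x‖ ^ 2 / (4 * ν * (s - t₀ + tstar)))))) =
      (∫ x, PlanarEigenmode.vorticity (u s) x * Real.log (PlanarEigenmode.vorticity (u s) x)) +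
        (∫ x, ‖x‖ ^ 2 * PlanarEigenmode.vorticity (u s) x) / (4 * ν * (s - t₀ + tstar)) +
          Γ * Real.log (4 * Real.pi * ν * (s - t₀ + tstar) / Γ) := by
    intro s hs hTs
    obtain ⟨-, his, -, hi2s, hilogs, -, -⟩ := slice_toolkit h hU hω hBS hpos hlog hsc hs
    rw [(integral_mul_log_div_gaussian_eq (hpos s hs) his hi2s hilogs hΓpos hν hTs).2, hΓs s hs,
      mul_comm (Real.log _) Γ]
  have hev : ∀ᶠ s in 𝓝[S] t, (fun s => ∫ x, PlanarEigenmode.vorticity (u s) x *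
      Real.log (PlanarEigenmode.vorticity (u s) x /
        (Γ / (4 * Real.pi * ν * (s - t₀ + tstar)) * Real.exp (-(‖x‖ ^ 2 / (4 * ν * (s - t₀ + tstar))))))) s =
      (fun s => (∫ x, PlanarEigenmode.vorticity (u s) x * Real.log (PlanarEigenmode.vorticity (u s) x)) +
        (∫ x, ‖x‖ ^ 2 * PlanarEigenmode.vorticity (u s) x) / (4 * ν * (s - t₀ + tstar)) +
          Γ * Real.log (4 * Real.pi * ν * (s - t₀ + tstar) / Γ)) s := by
    have hopen : IsOpen {s : ℝ | 0 < s - t₀ + tstar} :=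
      isOpen_lt continuous_const ((continuous_id.sub continuous_const).add continuous_const)
    have hmem : {s : ℝ | 0 < s - t₀ + tstar} ∈ 𝓝 t := hopen.mem_nhds hTt
    filter_upwards [inter_mem (mem_nhdsWithin_of_mem_nhds hmem) self_mem_nhdsWithin] with s hs
    exact hsplit s hs.2 hs.1
  exact hred.congr_of_eventuallyEq hev (hsplit t ht hTt)

/-! ### §4 The Stam–Gross inequality: `dH/dt ≤ −H/T`, so `H·T` is non-increasing -/

/-- **Gallay–Wayne 2005, §3.4, first display — the entropy decays like `e^{−τ}`.** In the
setting of `hasDerivWithinAt_relEntropy_planarVorticity`, for `t₀ ≤ t` in `S`: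
`H(t) · T(t) ≤ H(t₀) · t⋆`, i.e. `H(t) ≤ H(t₀) t⋆/(t − t₀ + t⋆)` — under `t − t₀ + t⋆ = t⋆ e^{τ}` this is
"`H(w(τ)) − H(αG) ≤ (H(w₀) − H(αG)) e^{−τ}`". Proof as printed: the dissipation law (§3) and the
Stam–Gross logarithmic Sobolev inequality `H ≤ νT · I_rel`
(`Literature.Analysis.FunctionSpaces.integral_mul_log_le_fisher` at `τ = νT`, Bakry–Gentil–Ledoux
Prop. 6.2.5) give `dH/dt ≤ −H/T`, whence `d/dt (H·T) ≤ 0` within `S ∩ [t₀, ∞)`.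
[cite: GallayWayne2005, §3.4 (p. 14, first display); BakryGentilLedoux2014, Prop. 6.2.5] -/
theorem IsClassicalNSSolutionOn.relEntropy_mul_le
    (h : IsClassicalNSSolutionOn S ν f u p) (hS : Convex ℝ S) (hν : 0 < ν)
    (hω : HasUniformRapidDecayOn S (fun t x => PlanarEigenmode.vorticity (u t) x))
    (hBS : ∀ s ∈ S, ∀ x, u s x = biotSavart2D (PlanarEigenmode.vorticity (u s)) x)
    (hcurl : ∀ s ∈ S, ∀ x, PlanarEigenmode.vorticity (f s) x = 0)
    (hpos : ∀ s ∈ S, ∀ x, 0 < PlanarEigenmode.vorticity (u s) x) {L : ℝ} {k : ℕ}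
    (hlog : ∀ s ∈ S, ∀ x, |Real.log (PlanarEigenmode.vorticity (u s) x)| ≤ L * (1 + ‖x‖) ^ k)
    (hsc : ∀ s ∈ S, ∀ x, ‖fderiv ℝ (PlanarEigenmode.vorticity (u s)) x‖ ≤
      L * (1 + ‖x‖) ^ k * PlanarEigenmode.vorticity (u s) x)
    {t₀ t tstar : ℝ} (ht₀ : t₀ ∈ S) (ht : t ∈ S) (hle : t₀ ≤ t) (htstar : 0 < tstar) :
    (∫ x, PlanarEigenmode.vorticity (u t) x * Real.log (PlanarEigenmode.vorticity (u t) x /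
        ((∫ y, PlanarEigenmode.vorticity (u t₀) y) / (4 * Real.pi * ν * (t - t₀ + tstar)) *
          Real.exp (-(‖x‖ ^ 2 / (4 * ν * (t - t₀ + tstar))))))) * (t - t₀ + tstar) ≤
      (∫ x, PlanarEigenmode.vorticity (u t₀) x * Real.log (PlanarEigenmode.vorticity (u t₀) x /
        ((∫ y, PlanarEigenmode.vorticity (u t₀) y) / (4 * Real.pi * ν * tstar) *
          Real.exp (-(‖x‖ ^ 2 / (4 * ν * tstar)))))) * tstar := by
  -- `t = t₀`: nothing to prove
  rcases hle.eq_or_lt with heq | hlt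
  · subst heq
    simp only [sub_self, zero_add, le_refl]
  have hU : UniqueDiffOn ℝ S := uniqueDiffOn_of_convex_of_lt hS ht₀ ht hlt
  set Γ : ℝ := ∫ y, PlanarEigenmode.vorticity (u t₀) y with hΓdef
  obtain ⟨-, -, hΓpos, -⟩ := slice_toolkit h hU hω hBS hpos hlog hsc ht₀
  have hΓs : ∀ s ∈ S, ∫ y, PlanarEigenmode.vorticity (u s) y = Γ := fun s hs =>
    (h.planarVorticity_moments_eq hS hω hBS hcurl ht₀ hs 0).1
  -- abbreviations: entropy, second moment, Fisher information, reduced entropy, and `G = Hred · T`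
  set Sf : ℝ → ℝ := fun s =>
    ∫ x, PlanarEigenmode.vorticity (u s) x * Real.log (PlanarEigenmode.vorticity (u s) x) with hSf
  set M₂ : ℝ → ℝ := fun s => ∫ x, ‖x‖ ^ 2 * PlanarEigenmode.vorticity (u s) x with hM₂
  set J : ℝ → ℝ := fun s => ∫ x, ‖fderiv ℝ (PlanarEigenmode.vorticity (u s)) x‖ ^ 2 /
    PlanarEigenmode.vorticity (u s) x with hJ
  set Hred : ℝ → ℝ := fun s => Sf s + M₂ s / (4 * ν * (s - t₀ + tstar)) +
    Γ * Real.log (4 * Real.pi * ν * (s - t₀ + tstar) / Γ) with hHred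
  set G : ℝ → ℝ := fun s => Hred s * (s - t₀ + tstar) with hG
  set D : Set ℝ := S ∩ Ici t₀ with hD
  have hΓpos' : 0 < Γ := hΓpos
  have hDc : Convex ℝ D := hS.inter (convex_Ici t₀)
  have hDS : D ⊆ S := inter_subset_left
  have hTpos : ∀ s ∈ D, 0 < s - t₀ + tstar := fun s hs => by
    have : t₀ ≤ s := hs.2; linarith
  -- the derivative of `G` within `S` on `D`, and its sign (Stam–Gross)
  have hGd : ∀ s ∈ D, HasDerivWithinAt G
      ((-(ν * J s) + 2 * Γ / (s - t₀ + tstar) - M₂ s / (4 * ν * (s - t₀ + tstar) ^ 2)) *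
        (s - t₀ + tstar) + Hred s * 1) S s := by
    intro s hs
    have hred := hasDerivWithinAt_relEntropyRed h hS hU hν hω hBS hcurl hpos hlog hsc ht₀ (hDS hs)
      (hTpos s hs)
    have hTd : HasDerivWithinAt (fun r => r - t₀ + tstar) 1 S s :=
      ((hasDerivWithinAt_id s S).sub_const t₀).add_const tstar
    exact hred.mul hTd
  have hGd0 : ∀ s ∈ D, (-(ν * J s) + 2 * Γ / (s - t₀ + tstar) - M₂ s / (4 * ν * (s - t₀ + tstar) ^ 2)) *
      (s - t₀ + tstar) + Hred s * 1 ≤ 0 := by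
    intro s hs
    have hT := hTpos s hs
    obtain ⟨hw1, hi, hipos, -, hilog, hiF, -⟩ :=
      slice_toolkit h hU hω hBS hpos hlog hsc (hDS hs)
    -- the Stam–Gross inequality at `τ = νT(s)`
    have hLSI := Literature.Analysis.FunctionSpaces.integral_mul_log_le_fisher hw1 (hpos s (hDS hs))
      hi hilog hiF hipos (τ := ν * (s - t₀ + tstar)) (by positivity)
    rw [hΓs s (hDS hs)] at hLSI
    have hlog4 : Real.log (4 * Real.pi * ν * (s - t₀ + tstar) / Γ) =
        Real.log (4 * Real.pi * (ν * (s - t₀ + tstar))) - Real.log Γ := by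
      rw [Real.log_div (by positivity) hΓpos'.ne']; ring_nf
    have e : (-(ν * J s) + 2 * Γ / (s - t₀ + tstar) - M₂ s / (4 * ν * (s - t₀ + tstar) ^ 2)) *
        (s - t₀ + tstar) + Hred s * 1 =
        Sf s + 2 * Γ + Γ * Real.log (4 * Real.pi * ν * (s - t₀ + tstar) / Γ) -
          ν * (s - t₀ + tstar) * J s := by
      rw [hHred]
      field_simp
      ring
    rw [e, hlog4]
    have hn : ((2 : ℕ) : ℝ) + ((2 : ℕ) : ℝ) / 2 * Real.log (4 * Real.pi * (ν * (s - t₀ + tstar))) =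
        2 + Real.log (4 * Real.pi * (ν * (s - t₀ + tstar))) := by norm_num
    rw [hn] at hLSI
    rw [hSf, hJ]
    nlinarith [hLSI, hΓpos']
  -- `G` is non-increasing on `D`
  have hGanti : AntitoneOn G D := by
    refine antitoneOn_of_hasDerivWithinAt_nonpos hDc (fun s hs => ((hGd s hs).continuousWithinAt).mono hDS)
      (fun s hs => ((hGd s (interior_subset hs)).mono (interior_subset.trans hDS))) fun s hs =>
      hGd0 s (interior_subset hs)
  have ht₀D : t₀ ∈ D := ⟨ht₀, le_refl t₀⟩
  have htD : t ∈ D := ⟨ht, hle⟩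
  have hGle := hGanti ht₀D htD hle
  -- unfold `G` at `t` and `t₀`
  have hsplit : ∀ s ∈ D,
      ∫ x, PlanarEigenmode.vorticity (u s) x * Real.log (PlanarEigenmode.vorticity (u s) x /
        (Γ / (4 * Real.pi * ν * (s - t₀ + tstar)) * Real.exp (-(‖x‖ ^ 2 / (4 * ν * (s - t₀ + tstar)))))) =
      Hred s := by
    intro s hs
    obtain ⟨-, his, -, hi2s, hilogs, -, -⟩ :=
      slice_toolkit h hU hω hBS hpos hlog hsc (hDS hs)
    rw [hHred, (integral_mul_log_div_gaussian_eq (hpos s (hDS hs)) his hi2s hilogs hΓpos hν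
      (hTpos s hs)).2, hΓs s (hDS hs), mul_comm (Real.log _) Γ]
  rw [hsplit t htD]
  have h0 := hsplit t₀ ht₀D
  simp only [sub_self, zero_add] at h0
  rw [h0]
  have e1 : G t = Hred t * (t - t₀ + tstar) := rfl
  have e2 : G t₀ = Hred t₀ * tstar := by simp [hG]
  rw [← e1, ← e2]
  exact hGle

/-- **Lemma 3.2 as printed: the relative entropy is non-increasing**, `H(t) ≤ H(t₀)` for
`t₀ ≤ t` in `S` (from `H·T ↓` and `H ≥ 0`, Gibbs' inequality). [cite: GallayWayne2005, Lemma 3.2 (p. 11)] -/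
theorem IsClassicalNSSolutionOn.relEntropy_le
    (h : IsClassicalNSSolutionOn S ν f u p) (hS : Convex ℝ S) (hν : 0 < ν)
    (hω : HasUniformRapidDecayOn S (fun t x => PlanarEigenmode.vorticity (u t) x))
    (hBS : ∀ s ∈ S, ∀ x, u s x = biotSavart2D (PlanarEigenmode.vorticity (u s)) x)
    (hcurl : ∀ s ∈ S, ∀ x, PlanarEigenmode.vorticity (f s) x = 0)
    (hpos : ∀ s ∈ S, ∀ x, 0 < PlanarEigenmode.vorticity (u s) x) {L : ℝ} {k : ℕ}
    (hlog : ∀ s ∈ S, ∀ x, |Real.log (PlanarEigenmode.vorticity (u s) x)| ≤ L * (1 + ‖x‖) ^ k)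
    (hsc : ∀ s ∈ S, ∀ x, ‖fderiv ℝ (PlanarEigenmode.vorticity (u s)) x‖ ≤
      L * (1 + ‖x‖) ^ k * PlanarEigenmode.vorticity (u s) x)
    {t₀ t tstar : ℝ} (ht₀ : t₀ ∈ S) (ht : t ∈ S) (hle : t₀ ≤ t) (htstar : 0 < tstar) :
    ∫ x, PlanarEigenmode.vorticity (u t) x * Real.log (PlanarEigenmode.vorticity (u t) x /
        ((∫ y, PlanarEigenmode.vorticity (u t₀) y) / (4 * Real.pi * ν * (t - t₀ + tstar)) *
          Real.exp (-(‖x‖ ^ 2 / (4 * ν * (t - t₀ + tstar)))))) ≤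
      ∫ x, PlanarEigenmode.vorticity (u t₀) x * Real.log (PlanarEigenmode.vorticity (u t₀) x /
        ((∫ y, PlanarEigenmode.vorticity (u t₀) y) / (4 * Real.pi * ν * tstar) *
          Real.exp (-(‖x‖ ^ 2 / (4 * ν * tstar))))) := by
  rcases hle.eq_or_lt with heq | hlt
  · subst heq
    simp only [sub_self, zero_add, le_refl]
  have hU : UniqueDiffOn ℝ S := uniqueDiffOn_of_convex_of_lt hS ht₀ ht hlt
  have hmain := h.relEntropy_mul_le hS hν hω hBS hcurl hpos hlog hsc ht₀ ht hle htstar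
  set Γ : ℝ := ∫ y, PlanarEigenmode.vorticity (u t₀) y with hΓdef
  have hTt : 0 < t - t₀ + tstar := by linarith
  obtain ⟨-, -, hΓpos, -⟩ := slice_toolkit h hU hω hBS hpos hlog hsc ht₀
  obtain ⟨-, hi, -, hi2, hilog, -, -⟩ := slice_toolkit h hU hω hBS hpos hlog hsc ht
  have hΓt : ∫ y, PlanarEigenmode.vorticity (u t) y = Γ :=
    (h.planarVorticity_moments_eq hS hω hBS hcurl ht₀ ht 0).1
  obtain ⟨hgpos, hgi, hgint, -⟩ := gaussian_facts hΓpos hν hTt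
  -- `H(t) ≥ 0` (Gibbs)
  have hH0 : 0 ≤ ∫ x, PlanarEigenmode.vorticity (u t) x * Real.log (PlanarEigenmode.vorticity (u t) x /
      (Γ / (4 * Real.pi * ν * (t - t₀ + tstar)) * Real.exp (-(‖x‖ ^ 2 / (4 * ν * (t - t₀ + tstar)))))) :=
    Literature.Analysis.FunctionSpaces.integral_mul_log_div_nonneg (fun x => (hpos t ht x).le) hgpos hi hgi
      (integral_mul_log_div_gaussian_eq (hpos t ht) hi hi2 hilog hΓpos hν hTt).1 (by rw [hΓt, hgint])
  have htT : tstar ≤ t - t₀ + tstar := by linarith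
  nlinarith [hmain, hH0, htT]

/-! ### §5 The Csiszár–Kullback–Pinsker inequality: the explicit `L¹` relaxation rate -/

/-- **Gallay–Wayne 2005, §3.4, second display — explicit `L¹` convergence to the Oseen vortex.**
In the setting of `relEntropy_mul_le` (classical planar solution on a convex time set, curl-free
force, `u = K₂ ∗ ω`, positive log-tame vorticity with uniform rapid decay; `t₀ ≤ t` in `S`,
`t⋆ > 0`, `T(t) = t − t₀ + t⋆`, `Γ = ∫ ω(t₀)`, `g_t = Γ(4πνT)⁻¹e^{−‖x‖²/(4νT)}`):
`∫ |ω(t) − g_t| ≤ √(2 Γ H(t₀) t⋆ / T(t))`, `H(t₀) = ∫ ω(t₀) log(ω(t₀)/g_{t₀})` — under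
`T = t⋆ e^{τ}` this is "`‖w(τ) − αG‖_{L¹} ≤ √(2α) (H(w₀) − H(αG))^{1/2} e^{−τ/2}`", an explicit
upper bound of the time needed to enter a given `L¹`-neighbourhood of the vortex. Proof as printed:
`relEntropy_mul_le` and the Csiszár–Kullback–Pinsker inequality
(`Literature.Analysis.FunctionSpaces.integral_abs_sub_le_sqrt`).
[cite: GallayWayne2005, §3.4 (p. 14, second display); BoucheronLugosiMassart2013, Thm. 4.19] -/
theorem IsClassicalNSSolutionOn.integral_abs_planarVorticity_sub_gaussian_le
    (h : IsClassicalNSSolutionOn S ν f u p) (hS : Convex ℝ S) (hν : 0 < ν)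
    (hω : HasUniformRapidDecayOn S (fun t x => PlanarEigenmode.vorticity (u t) x))
    (hBS : ∀ s ∈ S, ∀ x, u s x = biotSavart2D (PlanarEigenmode.vorticity (u s)) x)
    (hcurl : ∀ s ∈ S, ∀ x, PlanarEigenmode.vorticity (f s) x = 0)
    (hpos : ∀ s ∈ S, ∀ x, 0 < PlanarEigenmode.vorticity (u s) x) {L : ℝ} {k : ℕ}
    (hlog : ∀ s ∈ S, ∀ x, |Real.log (PlanarEigenmode.vorticity (u s) x)| ≤ L * (1 + ‖x‖) ^ k)
    (hsc : ∀ s ∈ S, ∀ x, ‖fderiv ℝ (PlanarEigenmode.vorticity (u s)) x‖ ≤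
      L * (1 + ‖x‖) ^ k * PlanarEigenmode.vorticity (u s) x)
    {t₀ t tstar : ℝ} (ht₀ : t₀ ∈ S) (ht : t ∈ S) (hle : t₀ ≤ t) (htstar : 0 < tstar) :
    ∫ x, |PlanarEigenmode.vorticity (u t) x -
        (∫ y, PlanarEigenmode.vorticity (u t₀) y) / (4 * Real.pi * ν * (t - t₀ + tstar)) *
          Real.exp (-(‖x‖ ^ 2 / (4 * ν * (t - t₀ + tstar))))| ≤
      Real.sqrt (2 * (∫ y, PlanarEigenmode.vorticity (u t₀) y) *
        (∫ x, PlanarEigenmode.vorticity (u t₀) x * Real.log (PlanarEigenmode.vorticity (u t₀) x /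
          ((∫ y, PlanarEigenmode.vorticity (u t₀) y) / (4 * Real.pi * ν * tstar) *
            Real.exp (-(‖x‖ ^ 2 / (4 * ν * tstar)))))) * tstar / (t - t₀ + tstar)) := by
  set Γ : ℝ := ∫ y, PlanarEigenmode.vorticity (u t₀) y with hΓdef
  have hTt : 0 < t - t₀ + tstar := by linarith
  have hmain := h.relEntropy_mul_le hS hν hω hBS hcurl hpos hlog hsc ht₀ ht hle htstar
  obtain ⟨-, -, hΓpos, -⟩ := slice_basic h hω hpos hlog (k := k) ht₀
  obtain ⟨-, hi, -, hi2, hilog, -⟩ := slice_basic h hω hpos hlog (k := k) ht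
  have hΓt : ∫ y, PlanarEigenmode.vorticity (u t) y = Γ :=
    (h.planarVorticity_moments_eq hS hω hBS hcurl ht₀ ht 0).1
  obtain ⟨hgpos, hgi, hgint, -⟩ := gaussian_facts hΓpos hν hTt
  have hP := Literature.Analysis.FunctionSpaces.integral_abs_sub_le_sqrt (fun x => (hpos t ht x).le)
    hgpos hi hgi (integral_mul_log_div_gaussian_eq (hpos t ht) hi hi2 hilog hΓpos hν hTt).1
    (by rw [hΓt, hgint])
  rw [hgint] at hP
  refine hP.trans (Real.sqrt_le_sqrt ?_)
  rw [le_div_iff₀ hTt]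
  have h2 := mul_le_mul_of_nonneg_left hmain (by positivity : (0 : ℝ) ≤ 2 * Γ)
  linarith [h2]

end Planar

end Literature.Analysis.FluidPDE

end
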